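import Mathlib
import HarnessLib
import Literature.MathematicalPhysics.QuantumFieldTheory.FariaDaVeigaOCarroll2022.FdVOC22MultiReflectionBound
import Literature.MathematicalPhysics.QuantumLattice.CloverPseudoscalarParity
import Literature.MathematicalPhysics.QuantumLattice.CloverObservables
import Summits.Ventures.LatticeQCDFlow.Scoring.WilsonFlowRK3Consistency

/-!
# Reflection positivity for the FLOWED charge: for every reflection-covariant smoothing map `Φ`, the correlator of `P_x ∘ Φ` with its mirror image is non-positive as soon as the smoothed density is supported in the half-space — and the engine's RK3 flow is such a map

HONEST FRAMING: exact (Metropolis-corrected) sampling algorithms for lattice gauge theory;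
figures of merit are autocorrelation/cost numbers at stated couplings and volumes; no
continuum-physics claim.

Venture `LatticeQCDFlow` (cell pub-lqcd), topic `Exactness`, FANOUT row 21 (`su3-base`: the scored charge is the clover charge of
the SMOOTHED field — `Q_m = Σ_x P_x ∘ RK3_{ε'}^m` along the exactness subset; row 21's `Exactness/ChargeSlabCorrelatorRP` treats
the bare density and lists the flowed one as NOT CLAIMED because "its footprint grows with the smoothing radius").  This file
isolates exactly what the reflection-positivity argument needs from a smoothing map `Φ` on configurations:
(a) COVARIANCE `Φ(Θ'U) = Θ'(ΦU)` under the reflection, and (b) SUPPORT — the smoothed observable is still a function of the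
links of the positive half.  Given (a), the Literature's parity of the clover density (`cloverPseudoscalar_reflect`) makes
`P_x ∘ Φ` odd; given (b), the Literature's Osterwalder–Seiler positivity (`FariaDaVeigaOCarroll2022.integral_mul_negReflect_nonneg`,
every `β`, site plane; `integral_mul_timeReflect_nonneg`, `β ≥ 0`, link plane) applies.  Row 16's
`Scoring/WilsonFlowRK3Reflection.iterate_wilsonFlowRK3_negReflect` (via `WilsonFlowRK3Consistency`) supplies (a) for the engine's RK3 integrator of the `SU(n)`
Wilson flow and the site reflection; (b) is kept as an explicit HYPOTHESIS (the support radius of `RK3^m` is not typed in the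
tree).  NEW WORK of the cell, def-free; nothing is cited as a fact; no number.

* §1 ABSTRACT (any compact `G`, continuous unitary `ρ`, even `L`, any measurable `Φ`):
  **`integral_flowedCharge_mul_negReflect_nonpos`** — if `Φ ∘ Θ' = Θ' ∘ Φ` and the finite combination
  `F = Σ_k c_k P_{y_k} ∘ Φ` depends only on the site-positive and shared links, then `∫ F · (Σ_k c_k P_{θ'y_k} ∘ Φ) dμ_β ≤ 0`
  for EVERY `β`; **`integral_flowedCharge_mul_timeReflect_nonpos`** — the same across the link plane (`Φ ∘ Θ = Θ ∘ Φ`,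
  positive-time links, `β ≥ 0`).
* §2 THE ENGINE'S FLOW (`SU(n)`, fundamental representation, every `β`, `ε'`, `m`):
  **`integral_rk3Charge_mul_negReflect_nonpos`** — for every finite combination of flowed densities
  `Σ_k c_k P_{y_k}(RK3_{ε'}^m U)` that depends only on the site-positive and shared links,
  `∫ (Σ_k c_k P_{y_k} ∘ RK3^m)·(Σ_k c_k P_{θ'y_k} ∘ RK3^m) dμ_β ≤ 0`; in particular
  **`integral_rk3SlabCharge_mul_negReflect_nonpos`** — the FLOWED slab charge `Q_{m,t} = Σ_{x₀ = t} P_x ∘ RK3^m` satisfies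
  `⟨Q_{m,t} · (Σ_{x₀ = t} P_{θ'x} ∘ RK3^m)⟩_β ≤ 0` (the second factor is the flowed charge of the mirror slice `−t`) whenever
  `Q_{m,t}` is supported in the half-space.
NOT CLAIMED: the support radius of `RK3_{ε'}^m` (hypothesis `hdep`; it grows with `m`), hence no explicit range of slices; the
link-plane covariance of `RK3` (only the site plane is in the tree); anything at separations inside the smoothing footprint;
numbers.
-/

noncomputable section

namespace Summit.Ventures.LatticeQCDFlow.Exactness

open MeasureTheory
open Literature.MathematicalPhysics.QuantumFieldTheory
open Literature.MathematicalPhysics.QuantumLattice (cloverPseudoscalar cloverPseudoscalar_reflect continuous_cloverPseudoscalar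
  exists_abs_cloverPseudoscalar_le fundamentalRep continuous_fundamentalRep fundamentalRep_mem_unitaryGroup)
open Summit.Ventures.LatticeQCDFlow.Scoring (wilsonFlowRK3 iterate_wilsonFlowRK3_negReflect continuous_iterate_wilsonFlowRK3)

/-! ## §1 Abstract smoothing maps -/

section Abstract

variable {L N : ℕ} [NeZero L] {G : Type*} [Group G] [TopologicalSpace G] [IsTopologicalGroup G]
  [CompactSpace G] [MeasurableSpace G] [BorelSpace G] [SecondCountableTopology G] (ρ : G →* Matrix (Fin N) (Fin N) ℂ)

omit [IsTopologicalGroup G] in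
/-- A finite real combination of SMOOTHED clover densities `Σ_k c_k P_{y_k} ∘ Φ` is measurable and bounded (measurable `Φ`). -/
theorem measurable_bounded_sum_cloverPseudoscalar_comp (hρc : Continuous ρ)
    {Φ : GaugeConfig 4 L G → GaugeConfig 4 L G} (hΦ : Measurable Φ) {ι : Type*} (s : Finset ι) (c : ι → ℝ) (y : ι → Site 4 L) :
    Measurable (fun U : GaugeConfig 4 L G => ∑ k ∈ s, c k * cloverPseudoscalar ρ (y k) (Φ U)) ∧
      ∃ K : ℝ, ∀ U : GaugeConfig 4 L G, |∑ k ∈ s, c k * cloverPseudoscalar ρ (y k) (Φ U)| ≤ K := by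
  refine ⟨Finset.measurable_sum s fun k _ =>
    (((continuous_cloverPseudoscalar ρ hρc (y k)).measurable).comp hΦ).const_mul (c k), ?_⟩
  choose C hC using fun k => exists_abs_cloverPseudoscalar_le ρ hρc (R := ZMod L) (y k)
  refine ⟨∑ k ∈ s, |c k| * C k, fun U => (Finset.abs_sum_le_sum_abs _ _).trans (Finset.sum_le_sum fun k _ => ?_)⟩
  rw [abs_mul]
  exact mul_le_mul_of_nonneg_left (hC k (Φ U)) (abs_nonneg _)

/-- **SITE PLANE, EVERY `β`: reflection positivity for smoothed charge densities.**  If the smoothing map commutes with the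
site reflection, `Φ(Θ'U) = Θ'(ΦU)`, and `F = Σ_k c_k P_{y_k} ∘ Φ` is an observable of the site-positive and shared links, then
`∫ F · (Σ_k c_k P_{θ'y_k} ∘ Φ) dμ_β ≤ 0`. -/
theorem integral_flowedCharge_mul_negReflect_nonpos (hL : Even L) (hρc : Continuous ρ)
    (hρu : ∀ g, ρ g ∈ Matrix.unitaryGroup (Fin N) ℂ) (β : ℝ) {Φ : GaugeConfig 4 L G → GaugeConfig 4 L G} (hΦ : Measurable Φ)
    (hΦΘ : ∀ U : GaugeConfig 4 L G, Φ U.negReflect = (Φ U).negReflect) {ι : Type*} (s : Finset ι) (c : ι → ℝ)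
    (y : ι → Site 4 L)
    (hdep : DependsOn (fun U : GaugeConfig 4 L G => ∑ k ∈ s, c k * cloverPseudoscalar ρ (y k) (Φ U))
      ((WilsonSiteRP.sitePosEdges ∪ WilsonSiteRP.sharedEdges : Finset (Edge 4 L)) : Set (Edge 4 L))) :
    ∫ U, (∑ k ∈ s, c k * cloverPseudoscalar ρ (y k) (Φ U)) *
        (∑ k ∈ s, c k * cloverPseudoscalar ρ (Site.negReflect (y k)) (Φ U)) ∂(wilsonMeasure ρ β) ≤ 0 := by
  obtain ⟨hFm, hFb⟩ := measurable_bounded_sum_cloverPseudoscalar_comp ρ hρc hΦ s c y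
  have key := FariaDaVeigaOCarroll2022.integral_mul_negReflect_nonneg ρ hL hρc β hFm hFb hdep
  -- the density is odd: `P_x(Θ'W) = −P_{θ'x}(W)` (Literature parity, instantiated on the torus)
  have hodd : ∀ (W : GaugeConfig 4 L G) (x : Site 4 L),
      cloverPseudoscalar ρ x W.negReflect = -cloverPseudoscalar ρ (Site.negReflect x) W := fun W x =>
    cloverPseudoscalar_reflect ρ hρu (Site.negReflect (d := 4) (L := L))
      (fun z => by funext k; by_cases hk : k = 0 <;> [(subst hk; simp [Site.negReflect]; ring); simp [Site.negReflect, hk]])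
      (fun z i hi => by funext k; by_cases hk : k = 0 <;> [(subst hk; simp [Site.negReflect, hi.symm]); simp [Site.negReflect, hk]])
      W W.negReflect (fun z => by unfold GaugeConfig.negReflect; rw [if_pos rfl]; rfl)
      (fun z i hi => by unfold GaugeConfig.negReflect; rw [if_neg hi]) x
  have hrefl : ∀ U : GaugeConfig 4 L G, (∑ k ∈ s, c k * cloverPseudoscalar ρ (y k) (Φ U.negReflect)) =
      -∑ k ∈ s, c k * cloverPseudoscalar ρ (Site.negReflect (y k)) (Φ U) := by
    intro U
    rw [hΦΘ, ← Finset.sum_neg_distrib]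
    exact Finset.sum_congr rfl fun k _ => by rw [hodd, mul_neg]
  simp only [hrefl, mul_neg, integral_neg] at key
  linarith

/-- **LINK PLANE, `β ≥ 0`: reflection positivity for smoothed charge densities.**  If `Φ(ΘU) = Θ(ΦU)` and
`F = Σ_k c_k P_{y_k} ∘ Φ` is an observable of the positive-time links, then `∫ F · (Σ_k c_k P_{θy_k} ∘ Φ) dμ_β ≤ 0`. -/
theorem integral_flowedCharge_mul_timeReflect_nonpos (hL : Even L) (hρc : Continuous ρ)
    (hρu : ∀ g, ρ g ∈ Matrix.unitaryGroup (Fin N) ℂ) {β : ℝ} (hβ : 0 ≤ β) {Φ : GaugeConfig 4 L G → GaugeConfig 4 L G}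
    (hΦ : Measurable Φ) (hΦΘ : ∀ U : GaugeConfig 4 L G, Φ U.timeReflect = (Φ U).timeReflect) {ι : Type*} (s : Finset ι)
    (c : ι → ℝ) (y : ι → Site 4 L)
    (hdep : DependsOn (fun U : GaugeConfig 4 L G => ∑ k ∈ s, c k * cloverPseudoscalar ρ (y k) (Φ U))
      {e : Edge 4 L | WilsonRP.IsPosEdge e}) :
    ∫ U, (∑ k ∈ s, c k * cloverPseudoscalar ρ (y k) (Φ U)) *
        (∑ k ∈ s, c k * cloverPseudoscalar ρ (Site.timeReflect (y k)) (Φ U)) ∂(wilsonMeasure ρ β) ≤ 0 := by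
  obtain ⟨hFm, hFb⟩ := measurable_bounded_sum_cloverPseudoscalar_comp ρ hρc hΦ s c y
  have key := FariaDaVeigaOCarroll2022.integral_mul_timeReflect_nonneg ρ hL hρc hβ hFm hFb hdep
  have hodd : ∀ (W : GaugeConfig 4 L G) (x : Site 4 L),
      cloverPseudoscalar ρ x W.timeReflect = -cloverPseudoscalar ρ (Site.timeReflect x) W := fun W x =>
    cloverPseudoscalar_reflect ρ hρu (Site.timeReflect (d := 4) (L := L))
      (fun z => by funext k; by_cases hk : k = 0 <;> [(subst hk; simp [Site.timeReflect]); simp [Site.timeReflect, hk]])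
      (fun z i hi => by funext k; by_cases hk : k = 0 <;> [(subst hk; simp [Site.timeReflect, hi.symm]); simp [Site.timeReflect, hk]])
      W W.timeReflect (fun z => by unfold GaugeConfig.timeReflect; rw [if_pos rfl]; rfl)
      (fun z i hi => by unfold GaugeConfig.timeReflect; rw [if_neg hi]) x
  have hrefl : ∀ U : GaugeConfig 4 L G, (∑ k ∈ s, c k * cloverPseudoscalar ρ (y k) (Φ U.timeReflect)) =
      -∑ k ∈ s, c k * cloverPseudoscalar ρ (Site.timeReflect (y k)) (Φ U) := by
    intro U
    rw [hΦΘ, ← Finset.sum_neg_distrib]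
    exact Finset.sum_congr rfl fun k _ => by rw [hodd, mul_neg]
  simp only [hrefl, mul_neg, integral_neg] at key
  linarith

end Abstract

/-! ## §2 The engine's RK3 Wilson flow -/

section RK3

variable {L n : ℕ} [NeZero L]

/-- **THE ENGINE'S FLOWED CHARGE ACROSS THE SITE PLANE** (`SU(n)`, fundamental representation, every `β`, `ε'`, `m`): for every
finite combination of flowed densities `F = Σ_k c_k P_{y_k} ∘ RK3_{ε'}^m` that is an observable of the site-positive and shared
links, `∫ F · (Σ_k c_k P_{θ'y_k} ∘ RK3^m) dμ_β ≤ 0`. -/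
theorem integral_rk3Charge_mul_negReflect_nonpos (hL : Even L) (β ε' : ℝ) (m : ℕ) {ι : Type*} (s : Finset ι)
    (c : ι → ℝ) (y : ι → Site 4 L)
    (hdep : DependsOn (fun U : GaugeConfig 4 L (Matrix.specialUnitaryGroup (Fin n) ℂ) =>
        ∑ k ∈ s, c k * cloverPseudoscalar (fundamentalRep (Fin n)) (y k) ((wilsonFlowRK3 ε')^[m] U))
      ((WilsonSiteRP.sitePosEdges ∪ WilsonSiteRP.sharedEdges : Finset (Edge 4 L)) : Set (Edge 4 L))) :
    ∫ U, (∑ k ∈ s, c k * cloverPseudoscalar (fundamentalRep (Fin n)) (y k) ((wilsonFlowRK3 ε')^[m] U)) *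
        (∑ k ∈ s, c k * cloverPseudoscalar (fundamentalRep (Fin n)) (Site.negReflect (y k)) ((wilsonFlowRK3 ε')^[m] U))
      ∂(wilsonMeasure (d := 4) (L := L) (fundamentalRep (Fin n)) β) ≤ 0 :=
  integral_flowedCharge_mul_negReflect_nonpos (fundamentalRep (Fin n)) hL (continuous_fundamentalRep (Fin n))
    (fundamentalRep_mem_unitaryGroup) β (continuous_iterate_wilsonFlowRK3 ε' m).measurable
    (fun U => iterate_wilsonFlowRK3_negReflect ε' m U) s c y hdep

/-- **THE FLOWED SLAB CHARGE ACROSS THE SITE PLANE**: with `Q_{m,t} = Σ_{x : x₀ = t} P_x ∘ RK3_{ε'}^m`, whenever `Q_{m,t}` is an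
observable of the site-positive and shared links (the flow footprint of the slice fits in the half `0 ≤ · ≤ L/2`),
`∫ Q_{m,t} · (Σ_{x : x₀ = t} P_{θ'x} ∘ RK3^m) dμ_β ≤ 0` — the second factor being the flowed charge of the mirror slice `−t`
(re-index `x ↦ θ'x`); every `β`, `ε'`, `m`. -/
theorem integral_rk3SlabCharge_mul_negReflect_nonpos (hL : Even L) (β ε' : ℝ) (m : ℕ) (t : ZMod L)
    (hdep : DependsOn (fun U : GaugeConfig 4 L (Matrix.specialUnitaryGroup (Fin n) ℂ) =>
        ∑ x ∈ Finset.univ.filter (fun x : Site 4 L => x 0 = t),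
          cloverPseudoscalar (fundamentalRep (Fin n)) x ((wilsonFlowRK3 ε')^[m] U))
      ((WilsonSiteRP.sitePosEdges ∪ WilsonSiteRP.sharedEdges : Finset (Edge 4 L)) : Set (Edge 4 L))) :
    ∫ U, (∑ x ∈ Finset.univ.filter (fun x : Site 4 L => x 0 = t),
          cloverPseudoscalar (fundamentalRep (Fin n)) x ((wilsonFlowRK3 ε')^[m] U)) *
        (∑ x ∈ Finset.univ.filter (fun x : Site 4 L => x 0 = t),
          cloverPseudoscalar (fundamentalRep (Fin n)) (Site.negReflect x) ((wilsonFlowRK3 ε')^[m] U))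
      ∂(wilsonMeasure (d := 4) (L := L) (fundamentalRep (Fin n)) β) ≤ 0 := by
  have h := integral_rk3Charge_mul_negReflect_nonpos (n := n) hL β ε' m
    (Finset.univ.filter (fun x : Site 4 L => x 0 = t)) (fun _ => 1) id (by simpa using hdep)
  simpa using h

end RK3

end Summit.Ventures.LatticeQCDFlow.Exactness
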